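import Summits.CriticalPhenomena.SAWScalingLimit.Theses.SAWPoissonBanks
import Summits.CriticalPhenomena.SAWScalingLimit.Theorems.SAWLoopFugacityFlowSLEAvoidanceValue
import Summits.CriticalPhenomena.SAWScalingLimit.Theorems.SAWLoopFugacityFlowAssembly
import Summits.CriticalPhenomena.SAWScalingLimit.Theorems.IsingBoundaryRatio.Negative.IsingBoundaryRatioNesting
import Literature.Probability.RandomPlanarGeometry.HullRestrictionSLEHolds
import Literature.Probability.RandomPlanarGeometry.SLEExistenceNeEightHolds
import Literature.Probability.RandomPlanarGeometry.SLEUniquenessInLaw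
import Literature.Probability.RandomPlanarGeometry.CritPercSLESimplePathHolds
import Literature.Probability.RandomPlanarGeometry.SimpleCurves
import Literature.Probability.RandomPlanarGeometry.LocalMartingaleProofs
import Literature.Probability.Percolation.CLE6Proofs

/-!
# `SAWPoissonBanks.MutualAvoidanceLaw` (stmt-CriticalPhenomena-4779) is a corollary of the
sub-problem `SAWScalingLimit`

Route `SAWPoissonBanks` of `CriticalPhenomena/SAWScalingLimit`, support item `MutualAvoidanceLaw`
("the route's typed falsifier", not used by the assembly): for two hull complements `F₁`, `F₂` of
a Dobrushin domain `(D; a, b)` on the same side, the critical-SAW log-covariance ratio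
`q_δ(E₁ ∩ E₂) / (q_δ(E₁) q_δ(E₂))`, `E_i = {range ⊆ cl F_i}`, converges as `δ → 0⁺` to the same
ratio under the chordal SLE_{8/3} law of `D`.

This file PROVES `SAWScalingLimit → MutualAvoidanceLaw` with NO other hypothesis: every input on
the SLE side is a theorem of the tree. Consequently a refutation of `MutualAvoidanceLaw` would
refute the sub-problem `SAWScalingLimit` as typed — the falsifier is sound. (With `F₁ = F₂` the
item contains the one-sided hull-avoidance law `q_δ(F) → Φ'_A(0)^{5/8}` for every endpoint
approximation, Lawler–Schramm–Werner's restriction-exponent prediction, which is open; so the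
converse direction is not available.)

## Proof

Fix `(D; a, b)`, an endpoint approximation, hull complements `F₁, F₂` and the SLE_{8/3} law `μ`
of `D`; let `ν_δ` be the critical SAW law pushed to `CurveClass ℂ`.

* `SAWScalingLimit` gives `ν_δ ⇒ law(Γ)` for some chordal SLE_{8/3} curve `Γ`, and
  `law(Γ) = μ` by uniqueness in law of chordal SLE (`IsSLECurve.map_eq_holds`).
* **Sandwich** (`tendsto_measure_of_sandwich`, portmanteau along `𝓝[>] 0`): for a closed event
  `E`, an open event `O` with `ν_δ(O) ≤ ν_δ(E)` eventually and `μ(E ∖ O) = 0`, one has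
  `ν_δ(E) → μ(E)` (`limsup ν_δ(E) ≤ μ(E)` for closed `E`; `μ(E) ≤ μ(O) ≤ liminf ν_δ(O)`).
* Take `E = {range ⊆ cl F}` (closed) and `O = {range ∩ cl(D ∖ F) = ∅}` (open). On the lattice,
  the polyline of a nontrivial walk of `Ω_δ` lies in `cl D = cl F ∪ cl(D ∖ F)`, so `O ⊆ E` for
  SAW curves (`mem_rangeSubset_closure_of_avoid`). Under `μ`, `E ∖ O` is contained in "the curve
  stays in `cl F` and meets `∂F` off `{a, b}`", which is null by [LSW] Thm. 6.1 transposed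
  (`IsSLELaw.hullRestriction_eightThirds_holds`, applied to that event) and the simplicity /
  boundary avoidance of SLE_{8/3} in `F` (`IsSLELaw.ae_simple`, Rohde–Schramm Thm. 6.1):
  `sle_measure_diff_avoid_eq_zero`. Intersections of two such pairs work the same way.
* `μ(E_i) = Φ'_{A_i}(0)^{5/8} > 0` (`SLEAvoidanceValue_proof`, [LSW] Thm. 6.1 and (2.4)), so the
  three limits combine into the limit of the ratio.

## References

* G. F. Lawler, O. Schramm, W. Werner, *Conformal restriction: the chordal case*, J. Amer. Math.
  Soc. 16 (2003), Thm. 6.1, §2 (2.4).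
* G. F. Lawler, O. Schramm, W. Werner, *On the scaling limit of planar self-avoiding walk*, Proc.
  Sympos. Pure Math. 72 (2004), §3.4 and Prediction 5 (restriction formula for the SAW limit).
* P. Billingsley, *Convergence of Probability Measures*, 2nd ed. (1999), Thm. 2.1 (portmanteau).
-/

noncomputable section

open MeasureTheory Filter Topology Set
open scoped NNReal ENNReal BoundedContinuousFunction
open Literature.Probability Literature.Probability.LatticeModels
open Literature.Probability.RandomPlanarGeometry

namespace Summit.CriticalPhenomena.SAWScalingLimit.Theorems

namespace MutualAvoidanceLaw

/-! ### The portmanteau sandwich along `𝓝[>] 0` -/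

/-- **Closed/open sandwich (portmanteau).** Let `ν_δ`, eventually probability measures on
`CurveClass ℂ`, converge weakly to the probability measure `μ` along `δ → 0⁺` (bounded continuous
test functions). If `E` is closed, `O` is open, eventually `ν_δ(O) ≤ ν_δ(E)`, and `μ(E ∖ O) = 0`,
then `ν_δ(E) → μ(E)`: `limsup ν_δ(E) ≤ μ(E)` (closed half of the portmanteau theorem) and
`μ(E) = μ(E ∩ O) ≤ μ(O) ≤ liminf ν_δ(O) ≤ liminf ν_δ(E)` (open half).
[cite: BillingsleyCPM1999, Thm. 2.1] -/
theorem tendsto_measure_of_sandwich {ν : ℝ → Measure (CurveClass ℂ)} {μ : Measure (CurveClass ℂ)}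
    [IsProbabilityMeasure μ]
    (hprob : ∀ᶠ δ in 𝓝[>] (0 : ℝ), IsProbabilityMeasure (ν δ))
    (hlim : ∀ f : CurveClass ℂ →ᵇ ℝ,
      Tendsto (fun δ ↦ ∫ x, f x ∂ν δ) (𝓝[>] (0 : ℝ)) (𝓝 (∫ x, f x ∂μ)))
    {E O : Set (CurveClass ℂ)} (hE : IsClosed E) (hO : IsOpen O)
    (hOE : ∀ᶠ δ in 𝓝[>] (0 : ℝ), ν δ O ≤ ν δ E) (hnull : μ (E \ O) = 0) :
    Tendsto (fun δ ↦ ν δ E) (𝓝[>] (0 : ℝ)) (𝓝 (μ E)) := by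
  classical
  let μP : ProbabilityMeasure (CurveClass ℂ) := ⟨μ, inferInstance⟩
  let P : ℝ → ProbabilityMeasure (CurveClass ℂ) := fun δ ↦
    if h : IsProbabilityMeasure (ν δ) then ⟨ν δ, h⟩ else μP
  have hPeq : ∀ᶠ δ in 𝓝[>] (0 : ℝ), ((P δ : ProbabilityMeasure (CurveClass ℂ)) :
      Measure (CurveClass ℂ)) = ν δ := by
    filter_upwards [hprob] with δ hδ
    simp only [P, dif_pos hδ, ProbabilityMeasure.coe_mk]
  have hPlim : Tendsto P (𝓝[>] (0 : ℝ)) (𝓝 μP) := by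
    rw [ProbabilityMeasure.tendsto_iff_forall_integral_tendsto]
    intro f
    refine (hlim f).congr' ?_
    filter_upwards [hPeq] with δ hδ
    rw [hδ]
  have hsup : limsup (fun δ ↦ ν δ E) (𝓝[>] (0 : ℝ)) ≤ μ E := by
    have h := ProbabilityMeasure.limsup_measure_closed_le_of_tendsto hPlim hE
    have hc : limsup (fun δ ↦ ν δ E) (𝓝[>] (0 : ℝ)) =
        limsup (fun δ ↦ ((P δ : ProbabilityMeasure (CurveClass ℂ)) : Measure (CurveClass ℂ)) E)
          (𝓝[>] (0 : ℝ)) :=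
      limsup_congr (hPeq.mono fun δ hδ ↦ by rw [hδ])
    rw [hc]
    exact h
  have hinf : μ E ≤ liminf (fun δ ↦ ν δ E) (𝓝[>] (0 : ℝ)) := by
    have h := ProbabilityMeasure.le_liminf_measure_open_of_tendsto hPlim hO
    have h2 : liminf (fun δ ↦ ((P δ : ProbabilityMeasure (CurveClass ℂ)) :
          Measure (CurveClass ℂ)) O) (𝓝[>] (0 : ℝ)) ≤
        liminf (fun δ ↦ ν δ E) (𝓝[>] (0 : ℝ)) := by
      refine liminf_le_liminf ?_
      filter_upwards [hPeq, hOE] with δ hδ hle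
      rw [hδ]
      exact hle
    have h3 : μ E ≤ μ O := by
      have hsplit : μ (E ∩ O) + μ (E \ O) = μ E := measure_inter_add_sdiff E hO.measurableSet
      calc μ E = μ (E ∩ O) + μ (E \ O) := hsplit.symm
        _ = μ (E ∩ O) := by rw [hnull, add_zero]
        _ ≤ μ O := measure_mono inter_subset_right
    exact h3.trans (h.trans h2)
  exact tendsto_of_le_liminf_of_limsup_le hinf hsup

/-! ### The SLE_{8/3} inputs (theorems of the tree) -/

/-- **Touching a hull boundary without entering is null for SLE_{8/3}.** For the chordal
SLE_{8/3} law `μ` of `(D; a, b)` and a hull subdomain `F` of `D`, the event "the trace stays in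
`cl F` but meets `cl (D ∖ F)`" is `μ`-null: such a trace meets `∂F` off `{a, b}`; by [LSW] Thm. 6.1
transposed (`μ_F(T) μ(E_F) = μ(T ∩ E_F)`) applied to `T = ` "meets `∂F` off the marked points",
which is null for the SLE_{8/3} law `μ_F` of `F` (Rohde–Schramm simplicity, `IsSLELaw.ae_simple`),
the event is `μ`-null. [cite: LawlerSchrammWerner2003Restriction, Thm. 6.1 (p. 23)] -/
theorem sle_measure_diff_avoid_eq_zero {D F : DobrushinDomain} (hF : D.IsHullSubdomain F)
    {μ : Measure (CurveClass ℂ)} (hμ : IsSLELaw ((8 : ℝ≥0) / 3) D μ) :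
    μ (CurveClass.rangeSubset (closure F.carrier) \
        CurveClass.rangeSubset (closure (D.carrier \ F.carrier))ᶜ) = 0 := by
  haveI : Fact Process.isProjectiveLimit_preWienerMeasure :=
    ⟨isProjectiveLimit_preWienerMeasure_holds⟩
  obtain ⟨Γ', hΓ'⟩ := exists_isSLECurve_eightThirds F
  have hμ' : IsSLELaw ((8 : ℝ≥0) / 3) F (Process.preWienerMeasure.map Γ') := hΓ'.isSLELaw_map
  have hκ0 : (0 : ℝ≥0) < 8 / 3 := by positivity
  have hκ4 : (8 : ℝ≥0) / 3 ≤ 4 := by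
    rw [div_le_iff₀ (by norm_num : (0 : ℝ≥0) < 3)]
    norm_num
  set S : Set (CurveClass ℂ) :=
    {γ | γ.range ∩ frontier F.carrier ⊆ {F.pt 0, F.pt 1}} with hS
  have hSm : MeasurableSet S :=
    CurveClass.measurableSet_range_inter_subset isClosed_frontier
      (Set.toFinite {F.pt 0, F.pt 1}).isClosed
  have hS0 : (Process.preWienerMeasure.map Γ') Sᶜ = 0 := by
    have hae := hμ'.ae_simple ae_isSimpleTrace_sleTrace_of_le_four_holds
      CurveClass.measurableSet_simple_holds hκ0 hκ4
    rw [measure_eq_zero_iff_ae_notMem]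
    filter_upwards [hae] with γ hγ hγS
    exact hγS hγ.2
  have hid := IsSLELaw.hullRestriction_eightThirds_apply hμ hμ' hF hSm.compl
  rw [hS0, zero_mul] at hid
  refine measure_mono_null ?_ hid.symm
  rintro γ ⟨hV, hO⟩
  refine ⟨fun hγS ↦ ?_, hV⟩
  rw [CurveClass.mem_rangeSubset] at hV
  rw [CurveClass.mem_rangeSubset, not_subset] at hO
  obtain ⟨z, hz, hzK⟩ := hO
  rw [mem_compl_iff, not_not] at hzK
  -- `z` is a point of the trace in `closure (D ∖ F)`; it lies on `∂F`, off the marked points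
  have hzF : z ∉ F.carrier := fun h ↦ by
    obtain ⟨w, hwF, hwDF⟩ := mem_closure_iff_nhds.1 hzK F.carrier (F.isOpen.mem_nhds h)
    exact hwDF.2 hwF
  have hzfr : z ∈ frontier F.carrier := by
    rw [frontier, F.isOpen.interior_eq]
    exact ⟨hV hz, hzF⟩
  have hz0 : z ≠ F.pt 0 := fun h ↦ hF.pt_zero_notMem (by
    rw [← hF.pt_zero_eq, ← h]
    exact hzK)
  have hz1 : z ≠ F.pt 1 := fun h ↦ hF.pt_one_notMem (by
    rw [← hF.pt_one_eq, ← h]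
    exact hzK)
  rcases hγS ⟨hz, hzfr⟩ with h | h
  · exact hz0 h
  · exact hz1 h

/-- **The SLE_{8/3} avoidance probability of a hull complement is positive**: for the chordal
SLE_{8/3} law `μ` of `(D; a, b)` and `F ⊆ D` with the same marked points agreeing with `D` near
them, `μ {range ⊆ cl F} = Φ'_A(0)^{5/8} > 0`, where `A` is the hull pulled back by a chordal
uniformizing map (`SLEAvoidanceValue_proof`, [LSW] Thm. 6.1 transposed) and `Φ'_A(0) ∈ (0, 1]`
([LSW] (2.4)). [cite: LawlerSchrammWerner2003Restriction, Thm. 6.1 (p. 23) and (2.4) (p. 7)] -/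
theorem sle_measure_rangeSubset_ne_zero {D F : DobrushinDomain} (hsub : F.carrier ⊆ D.carrier)
    (h0 : F.pt 0 = D.pt 0) (h1 : F.pt 1 = D.pt 1)
    (hε : ∃ ε : ℝ, 0 < ε ∧
      F.carrier ∩ Metric.ball (D.pt 0) ε = D.carrier ∩ Metric.ball (D.pt 0) ε ∧
      F.carrier ∩ Metric.ball (D.pt 1) ε = D.carrier ∩ Metric.ball (D.pt 1) ε)
    {μ : Measure (CurveClass ℂ)} (hμ : IsSLELaw ((8 : ℝ≥0) / 3) D μ) :
    μ (CurveClass.rangeSubset (closure F.carrier)) ≠ 0 := by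
  obtain ⟨φ, hφ⟩ := MarkedDomain.exists_isChordalUniformizing_holds D
  have hHull : D.IsHullSubdomain F :=
    IsingBoundaryRatio.Negative.isHullSubdomain_of_conds hsub h0 h1 hε
  have hstar : IsStarHull (φ.pullbackHull F) :=
    IsStarHull.pullbackHull JordanDomain.isSimplyConnected_holds hφ hHull
  obtain ⟨Φ, hΦ, -⟩ := IsStarHull.existsUnique_isRestrictionMap_holds hstar
  obtain ⟨d, hd0, -, hd⟩ := IsStarHull.exists_hasRestrictionDeriv_holds hstar hΦ
  have hval := SLEAvoidanceValue_proof D F μ hμ hsub h0 h1 hε φ hφ _ rfl Φ d hΦ hd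
  rw [hval]
  exact (ENNReal.ofReal_pos.2 (Real.rpow_pos_of_pos hd0 _)).ne'

/-! ### The lattice side -/

/-- **Lattice confinement**: the polyline of a nontrivial self-avoiding walk of `Ω_δ` lies in
`cl Ω` (its steps are mesh edges, whose closed segments lie in `cl Ω` by definition of the mesh
graph). [folklore] -/
theorem range_curve_subset_closure {Ω : Set ℂ} {δ : ℝ} {u v : Site 2} (huv : u ≠ v)
    (γ : SAW.DomainSAW Ω δ u v) : γ.curve.range ⊆ closure Ω := by
  change Set.range (γ.walk.toCurve (meshPoint δ)) ⊆ closure Ω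
  exact SimpleGraph.Walk.range_toCurve_subset_of_not_nil (SimpleGraph.Walk.not_nil_of_ne huv)
    fun d _ ↦ (meshGraph_adj_iff.1 (discreteDomainGraph_le_meshGraph Ω δ d.adj)).2

/-- A trace inside `cl Ω` which misses `cl (Ω ∖ F)`, `F ⊆ Ω`, lies in `cl F`
(`cl Ω = cl F ∪ cl (Ω ∖ F)`). [folklore] -/
theorem mem_rangeSubset_closure_of_avoid {Ω F : Set ℂ} (hF : F ⊆ Ω) {c : CurveClass ℂ}
    (hc : c.range ⊆ closure Ω) (hK : c ∈ (CurveClass.rangeSubset (closure (Ω \ F))ᶜ)) :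
    c ∈ CurveClass.rangeSubset (closure F) := by
  rw [CurveClass.mem_rangeSubset] at hK ⊢
  intro z hz
  have hsplit : closure Ω ⊆ closure F ∪ closure (Ω \ F) := by
    rw [← closure_union, Set.union_sdiff_cancel hF]
  rcases hsplit (hc hz) with h | h
  · exact h
  · exact absurd h (hK hz)

/-- Monotonicity of the pushed-forward SAW law along an implication valid for every SAW.
[folklore] -/
theorem map_law_mono {Ω : Set ℂ} {δ : ℝ} {u v : Site 2} {O E : Set (CurveClass ℂ)}
    (hO : MeasurableSet O) (hE : MeasurableSet E)
    (h : ∀ γ : SAW.DomainSAW Ω δ u v, γ.curve ∈ O → γ.curve ∈ E) :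
    (SAW.law Ω δ u v).map (fun γ ↦ γ.curve) O ≤ (SAW.law Ω δ u v).map (fun γ ↦ γ.curve) E := by
  rw [Measure.map_apply (SAW.DomainSAW.measurable_of_top _) hO,
    Measure.map_apply (SAW.DomainSAW.measurable_of_top _) hE]
  exact measure_mono fun γ hγ ↦ h γ hγ

end MutualAvoidanceLaw

open MutualAvoidanceLaw in
/-- **`MutualAvoidanceLaw` (stmt-CriticalPhenomena-4779) follows from `SAWScalingLimit`.** If the
critical planar SAW converges to chordal SLE_{8/3} (the sub-problem statement, for every Dobrushin
domain and endpoint approximation), then for hull complements `F₁, F₂` of `(D; a, b)` the SAW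
log-covariance ratio `q_δ(E₁ ∩ E₂) / (q_δ(E₁) q_δ(E₂))`, `E_i = {range ⊆ cl F_i}`, converges as
`δ → 0⁺` to the same ratio under the SLE_{8/3} law `μ` of `D`. Proof: `ν_δ(E) → μ(E)` for
`E ∈ {E₁, E₂, E₁ ∩ E₂}` by the portmanteau sandwich between the closed event `E` and the open
event "the trace misses `cl (D ∖ F)`" (equal on the lattice up to confinement in `cl D`, equal
under `μ` up to the null touching event, [LSW] Thm. 6.1 + Rohde–Schramm), and `μ(E_i) > 0`
([LSW] Thm. 6.1, value form). The only hypothesis is the open sub-problem itself: the item is a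
sound falsifier of `SAWScalingLimit`. [cite: LawlerSchrammWerner2003Restriction, Thm. 6.1 (p. 23)] -/
theorem MutualAvoidanceLaw_of_SAWScalingLimit (hS : _root_.SAWScalingLimit) :
    Summit.CriticalPhenomena.SAWScalingLimit.Theses.SAWPoissonBanks.MutualAvoidanceLaw := by
  intro D a b happ _j F₁ F₂ hF₁ hF₂ μ hμ
  obtain ⟨h1sub, h10, h11, -, h1ε⟩ := hF₁
  obtain ⟨h2sub, h20, h21, -, h2ε⟩ := hF₂
  haveI : Fact Process.isProjectiveLimit_preWienerMeasure :=
    ⟨isProjectiveLimit_preWienerMeasure_holds⟩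
  haveI : IsProbabilityMeasure μ := hμ.isProbabilityMeasure
  -- the scaling limit, identified with `μ` by uniqueness in law of chordal SLE
  obtain ⟨Γ, hΓ, -, hT⟩ := hS D a b happ
  have hμΓ : μ = Process.preWienerMeasure.map Γ := by
    obtain ⟨Γ', hΓ', rfl⟩ := hμ
    exact IsSLECurve.map_eq_holds hΓ' hΓ
  set ν : ℝ → Measure (CurveClass ℂ) := fun δ ↦
    (SAW.law D.carrier δ (a δ) (b δ)).map (fun γ ↦ γ.curve) with hν
  have hprob : ∀ᶠ δ in 𝓝[>] (0 : ℝ), IsProbabilityMeasure (ν δ) := by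
    filter_upwards [SAWLoopFugacityFlowAssembly.eventually_isProbabilityMeasure_law happ] with δ hδ
    exact Measure.isProbabilityMeasure_map (SAW.aemeasurable_curve _ _ _ _)
  have hlim : ∀ f : CurveClass ℂ →ᵇ ℝ,
      Tendsto (fun δ ↦ ∫ x, f x ∂ν δ) (𝓝[>] (0 : ℝ)) (𝓝 (∫ x, f x ∂μ)) := by
    intro f
    have h : Tendsto (fun δ ↦ ∫ γ, f γ.curve ∂(SAW.law D.carrier δ (a δ) (b δ))) (𝓝[>] (0 : ℝ))
        (𝓝 (∫ ω, f (Γ ω) ∂Process.preWienerMeasure)) := hT f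
    rw [hμΓ, integral_map hΓ.aemeasurable f.continuous.aestronglyMeasurable]
    refine h.congr' (Eventually.of_forall fun δ ↦ ?_)
    exact (integral_map (SAW.aemeasurable_curve _ _ _ _) f.continuous.aestronglyMeasurable).symm
  -- the events
  set E₁ : Set (CurveClass ℂ) := CurveClass.rangeSubset (closure F₁.carrier) with hE₁
  set E₂ : Set (CurveClass ℂ) := CurveClass.rangeSubset (closure F₂.carrier) with hE₂
  set O₁ : Set (CurveClass ℂ) :=
    (CurveClass.rangeSubset (closure (D.carrier \ F₁.carrier))ᶜ) with hO₁
  set O₂ : Set (CurveClass ℂ) :=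
    (CurveClass.rangeSubset (closure (D.carrier \ F₂.carrier))ᶜ) with hO₂
  have hE₁c : IsClosed E₁ := CurveClass.isClosed_rangeSubset isClosed_closure
  have hE₂c : IsClosed E₂ := CurveClass.isClosed_rangeSubset isClosed_closure
  have hO₁o : IsOpen O₁ := CurveClass.isOpen_rangeSubset isClosed_closure.isOpen_compl
  have hO₂o : IsOpen O₂ := CurveClass.isOpen_rangeSubset isClosed_closure.isOpen_compl
  -- hull subdomains; null touching; positivity
  have hH₁ : D.IsHullSubdomain F₁ :=
    IsingBoundaryRatio.Negative.isHullSubdomain_of_conds h1sub h10 h11 h1ε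
  have hH₂ : D.IsHullSubdomain F₂ :=
    IsingBoundaryRatio.Negative.isHullSubdomain_of_conds h2sub h20 h21 h2ε
  have hnull₁ : μ (E₁ \ O₁) = 0 := sle_measure_diff_avoid_eq_zero hH₁ hμ
  have hnull₂ : μ (E₂ \ O₂) = 0 := sle_measure_diff_avoid_eq_zero hH₂ hμ
  have hnull₁₂ : μ ((E₁ ∩ E₂) \ (O₁ ∩ O₂)) = 0 := by
    refine measure_mono_null ?_ (measure_union_null hnull₁ hnull₂)
    rintro γ ⟨⟨hγ1, hγ2⟩, hγO⟩
    by_cases h1 : γ ∈ O₁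
    · exact Or.inr ⟨hγ2, fun h2 ↦ hγO ⟨h1, h2⟩⟩
    · exact Or.inl ⟨hγ1, h1⟩
  have hpos₁ : μ E₁ ≠ 0 := sle_measure_rangeSubset_ne_zero h1sub h10 h11 h1ε hμ
  have hpos₂ : μ E₂ ≠ 0 := sle_measure_rangeSubset_ne_zero h2sub h20 h21 h2ε hμ
  -- lattice inclusions, eventually
  have hne := IsingBoundaryRatio.Negative.eventually_ne happ
  have hOE₁ : ∀ᶠ δ in 𝓝[>] (0 : ℝ), ν δ O₁ ≤ ν δ E₁ := by
    filter_upwards [hne] with δ hδ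
    exact map_law_mono hO₁o.measurableSet hE₁c.measurableSet fun γ hγ ↦
      mem_rangeSubset_closure_of_avoid h1sub (range_curve_subset_closure hδ γ) hγ
  have hOE₂ : ∀ᶠ δ in 𝓝[>] (0 : ℝ), ν δ O₂ ≤ ν δ E₂ := by
    filter_upwards [hne] with δ hδ
    exact map_law_mono hO₂o.measurableSet hE₂c.measurableSet fun γ hγ ↦
      mem_rangeSubset_closure_of_avoid h2sub (range_curve_subset_closure hδ γ) hγ
  have hOE₁₂ : ∀ᶠ δ in 𝓝[>] (0 : ℝ), ν δ (O₁ ∩ O₂) ≤ ν δ (E₁ ∩ E₂) := by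
    filter_upwards [hne] with δ hδ
    exact map_law_mono (hO₁o.inter hO₂o).measurableSet (hE₁c.inter hE₂c).measurableSet
      fun γ hγ ↦ ⟨mem_rangeSubset_closure_of_avoid h1sub (range_curve_subset_closure hδ γ) hγ.1,
        mem_rangeSubset_closure_of_avoid h2sub (range_curve_subset_closure hδ γ) hγ.2⟩
  -- the three limits
  have T₁ := tendsto_measure_of_sandwich hprob hlim hE₁c hO₁o hOE₁ hnull₁
  have T₂ := tendsto_measure_of_sandwich hprob hlim hE₂c hO₂o hOE₂ hnull₂
  have T₁₂ := tendsto_measure_of_sandwich hprob hlim (hE₁c.inter hE₂c) (hO₁o.inter hO₂o)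
    hOE₁₂ hnull₁₂
  have t₁ := (ENNReal.tendsto_toReal (measure_ne_top μ E₁)).comp T₁
  have t₂ := (ENNReal.tendsto_toReal (measure_ne_top μ E₂)).comp T₂
  have t₁₂ := (ENNReal.tendsto_toReal (measure_ne_top μ (E₁ ∩ E₂))).comp T₁₂
  have hm₁ : (μ E₁).toReal ≠ 0 := ENNReal.toReal_ne_zero.2 ⟨hpos₁, measure_ne_top μ E₁⟩
  have hm₂ : (μ E₂).toReal ≠ 0 := ENNReal.toReal_ne_zero.2 ⟨hpos₂, measure_ne_top μ E₂⟩
  exact t₁₂.div (t₁.mul t₂) (mul_ne_zero hm₁ hm₂)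

end Summit.CriticalPhenomena.SAWScalingLimit.Theorems
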